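import Mathlib
import Literature.AlgebraicGeometry.Resolution.BlowupPrincipalCharts
import Literature.AlgebraicGeometry.Resolution.MarkedIdeals
import Literature.AlgebraicGeometry.Resolution.MarkedIdealsEtale
import Literature.AlgebraicGeometry.Resolution.AffineBlowupCartier

/-!
# On the principal chart `X'[U, g]` the exceptional ideal at every stalk is generated by `π^♯ g`

Crux stmt-ResolutionOfSingularities-15640 (`WildQuotients.WildQuotientResolution`), line `Sketch`;
programme V3U of CHAIN w45c v5, RULING v5.1 row **V3U-F-W** (res-L1-w45c-stub-3), adapter for
res-L1-w45c-lead-1's `ToricExit.I2.isPrincipal_stalkAug_liftAction_of_mem` (its hypothesis `hmem`: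
`π^♯ x_a ∈ (π^♯ x_b)² · 𝒪_{V,v}` at the points of the stable affine `W_b ⊆ X'[⊤, x_b²]`).
[OURS · L1 W4.5c] — generic scheme glue, NOT a statement of the manuscript.

* `stalkIdeal_comap_eq_span_of_mem_blowupChart`: for ANY morphism `π : X' → X`, ideal sheaf `I`,
  affine open `U` and `g ∈ Γ(X, U)`: at a point `v` of the principal chart `X'[U, g]`
  (Literature `blowupChart π I U g`) the inverse image ideal satisfies
  `(I·𝒪_{X'})_v = (π^♯_v g_{π v})`.
* `map_germ_mem_span_of_mem_blowupChart`: hence `π^♯_v f_{π v} ∈ (π^♯_v g_{π v})` for every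
  `f ∈ I(U)`.
* `map_germ_mem_span_of_mem_blowupChart_spec`: the `X = Spec R`, `U = ⊤`, `I = Ĩ` form with
  `f, g ∈ I ⊆ R` read through `ΓSpecIso` — literally the shape of `hmem`.
-/

-- single-problem summit: the doubled namespace component `ResolutionOfSingularities` is forced
set_option linter.dupNamespace false

noncomputable section

universe u

open CategoryTheory AlgebraicGeometry TopologicalSpace
open Literature.AlgebraicGeometry.Resolution

namespace Summit.ResolutionOfSingularities.ResolutionOfSingularities.Theorems.WildQuotientResolution.BlowupExit

/-- **On the principal chart `X'[U, g]` the stalks of the inverse image ideal are generated by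
`π^♯ g`.** (A point of `X'[U, g]` has an affine neighbourhood `W` over `U` on which
`(I·𝒪_{X'})(W) = (π^* g)` — `mem_blowupChart_iff` / `IsPrincipalChart` — and stalk ideals are
generated by sections, `stalkIdeal_eq_map_germ`.) [cite: StacksProject, Tag 0804] -/
theorem stalkIdeal_comap_eq_span_of_mem_blowupChart {X' X : Scheme.{u}} (π : X' ⟶ X)
    (I : X.IdealSheafData) (U : X.affineOpens) (g : Γ(X, U)) {v : X'}
    (hv : v ∈ blowupChart π I U g) :
    stalkIdeal (I.comap π) v =
      Ideal.span {(π.stalkMap v).hom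
        ((X.presheaf.germ U (π.base v) (blowupChart_le_preimage π I U g hv)).hom g)} := by
  obtain ⟨W, ⟨h, -, hideal⟩, hvW⟩ := mem_blowupChart_iff.mp hv
  rw [stalkIdeal_eq_map_germ (I.comap π) W hvW, hideal, Ideal.map_span, Set.image_singleton]
  congr 2
  change (π.appLE U W h ≫ X'.presheaf.germ W v hvW).hom g =
    (X.presheaf.germ U (π.base v) _ ≫ π.stalkMap v).hom g
  rw [Scheme.Hom.germ_stalkMap, Scheme.Hom.appLE, Category.assoc, X'.presheaf.germ_res]

/-- **On `X'[U, g]`, `π^♯ f ∈ (π^♯ g) · 𝒪_{X',v}` for every `f ∈ I(U)`.**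
[cite: StacksProject, Tag 0804] -/
theorem map_germ_mem_span_of_mem_blowupChart {X' X : Scheme.{u}} (π : X' ⟶ X)
    (I : X.IdealSheafData) (U : X.affineOpens) (g : Γ(X, U)) {v : X'}
    (hv : v ∈ blowupChart π I U g) {f : Γ(X, U)} (hf : f ∈ I.ideal U) :
    (π.stalkMap v).hom ((X.presheaf.germ U (π.base v) (blowupChart_le_preimage π I U g hv)).hom f) ∈
      Ideal.span {(π.stalkMap v).hom
        ((X.presheaf.germ U (π.base v) (blowupChart_le_preimage π I U g hv)).hom g)} := by
  rw [← stalkIdeal_comap_eq_span_of_mem_blowupChart π I U g hv, stalkIdeal_comap_eq_map,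
    stalkIdeal_eq_map_germ I U (blowupChart_le_preimage π I U g hv), Ideal.map_map]
  exact Ideal.mem_map_of_mem _ hf

/-- **The `Spec` form (shape of `ToricExit.I2.isPrincipal_stalkAug_liftAction_of_mem`'s `hmem`):**
for `π : V → Spec R`, an ideal `I ⊆ R`, `f, g ∈ I`, and a point `v` of the principal chart
`V[⊤, g]` of `π` for the ideal sheaf `Ĩ = affineBlowup.idealSheaf I`:
`π^♯_v (γ f) ∈ (π^♯_v (γ g))`, where `γ = ΓSpecIso⁻¹ ≫ germ_⊤` is the germ map `R → 𝒪_{Spec R, π v}`.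
[cite: StacksProject, Tag 0804] -/
theorem map_germ_mem_span_of_mem_blowupChart_spec {R : CommRingCat.{u}} {V : Scheme.{u}}
    (π : V ⟶ Spec R) (I : Ideal R) {f g : R} (hf : f ∈ I) {v : V}
    (hv : v ∈ blowupChart π (affineBlowup.idealSheaf I) ⟨⊤, isAffineOpen_top _⟩
      ((Scheme.ΓSpecIso R).inv g)) :
    (π.stalkMap v).hom (((Scheme.ΓSpecIso R).inv ≫
        (Spec R).presheaf.germ ⊤ (π.base v) trivial).hom f) ∈
      Ideal.span {(π.stalkMap v).hom (((Scheme.ΓSpecIso R).inv ≫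
        (Spec R).presheaf.germ ⊤ (π.base v) trivial).hom g)} := by
  have hf' : (Scheme.ΓSpecIso R).inv f ∈
      (affineBlowup.idealSheaf I).ideal ⟨⊤, isAffineOpen_top (Spec R)⟩ := by
    change _ ∈ (Scheme.IdealSheafData.ofIdealTop _).ideal ⟨⊤, isAffineOpen_top (Spec R)⟩
    rw [ideal_ofIdealTop_top]
    exact Ideal.mem_map_of_mem _ hf
  exact map_germ_mem_span_of_mem_blowupChart π (affineBlowup.idealSheaf I)
    ⟨⊤, isAffineOpen_top _⟩ ((Scheme.ΓSpecIso R).inv g) hv hf'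

end Summit.ResolutionOfSingularities.ResolutionOfSingularities.Theorems.WildQuotientResolution.BlowupExit

end
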